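import Summits.ResolutionOfSingularities.ResolutionOfSingularities.Theorems.RadicialJungCleanModelsStubGenerator
import Summits.ResolutionOfSingularities.ResolutionOfSingularities.Theorems.RadicialJungCleanModelsStubDvrNormalization
import Summits.ResolutionOfSingularities.ResolutionOfSingularities.Theorems.RadicialJungCleanModelsStubDvrClean
import Summits.ResolutionOfSingularities.ResolutionOfSingularities.Theorems.RadicialJungCleanModelsStubCurveStalks
import Literature.RingTheory.RegularLocalRing.QuotientDVR
import HarnessLib

/-!
# Route `RadicialJung`, crux `CleanModels` (stmt-15917): clean generators at codimension-one points

Support lemma (OURS) for the research stub `stub_cleanModels` = crux `RadicialJung.CleanModels`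
(stmt-ResolutionOfSingularities-15917; the one stub of the registered `DescentPerfectToAll` line
`via-clean-models`, W8.1), item K1 of the successor programme
`HOME/L/res-L0-w81-pv-2/g3/PROGRAMME-clean-dim2.md` ("LEMMA E (excellence ⇒ ν < ∞) or a substitute
sufficient for termination at codim-1 points") in its SUBSTITUTE form: no excellence lemma and no
iteration are needed at a point whose local ring is a discrete valuation ring — E. Noether's
finiteness of the normalisation (tree `finite_integralClosure_stalk`, any point of any variety)
makes the normalisation of `𝒪_{V,v}` in `L` a DVR `B` with `B^p ⊆ 𝒪_{V,v}` (`stub_dvrNormalization`),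
and `e·f = p` hands over a clean generator at once (`stub_dvrClean`). This is the closed-point half
of the landed calibration `cleanModels_dim_le_one`, freed of the hypothesis `dim V ≤ 1`: it applies
at the generic point of every curve on a regular surface (or of every prime divisor of a regular
variety).

* `exists_clean_generator_of_isDiscreteValuationRing_stalk` — `V` integral, locally of finite type
  over a field of characteristic `p`, `L/K(V)` purely inseparable of degree `p`, `𝒪_{V,v}` a DVR:
  there is `y ∈ L ∖ K(V)` with `y^p = s ∈ 𝒪_{V,v}` and EITHER `s` a uniformizer (`𝔪_v = (s)`:
  toroidal type, `m = d = 1`, exponent `1`) OR `s` a unit with `s - c^p ∉ 𝔪_v` for all `c`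
  (regular type (i)).
* `exists_clean_generator_of_ringKrullDim_stalk_eq_one` — the same at any point `v` with
  `𝒪_{V,v}` regular of dimension one (codimension-one points of a regular `V`).

Nothing here is a statement of Hironaka's manuscript; nothing bears on the crux `DescentPerfectToAll`
or the summit as stated. [cite: Liu2002, Prop. 4.1.27] [cite: Matsumura1987, Thm. 11.2]
-/

noncomputable section

set_option linter.dupNamespace false -- mandated namespace of this single-conjunct summit

open CategoryTheory AlgebraicGeometry TopologicalSpace IsLocalRing
open Literature.AlgebraicGeometry.Resolution

namespace Summit.ResolutionOfSingularities.ResolutionOfSingularities.Theorems.RadicialJung.CleanModels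

/-- **Clean generators at DVR points.** Let `V` be an integral scheme locally of finite type over
a field `k` of characteristic `p`, `L/K(V)` purely inseparable of degree `p`, and `v ∈ V` a point
whose local ring is a discrete valuation ring. Then some `y ∈ L ∖ K(V)` has `y^p = s ∈ 𝒪_{V,v}`
with `s` a UNIFORMIZER of `𝒪_{V,v}` (`𝔪_v = (s)`) or a UNIT which is not a `p`-th power modulo
`𝔪_v`. (Normalisation `B` of `𝒪_{V,v}` in `L`: finite by E. Noether, hence a DVR with `B^p ⊆ 𝒪_{V,v}`
and `B ⊄ K(V)`; then `e f = p` — `stub_dvrNormalization`, `stub_dvrClean`.) [cite: Liu2002, Prop. 4.1.27] -/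
theorem exists_clean_generator_of_isDiscreteValuationRing_stalk (p : ℕ) (hp : p.Prime)
    (k : Type) [Field k] [CharP k p] (V : Scheme.{0}) [IsIntegral V] (f : V ⟶ Spec (.of k))
    [LocallyOfFiniteType f] (L : Type) [Field L] [Algebra V.functionField L]
    [IsPurelyInseparable V.functionField L] (hdeg : Module.finrank V.functionField L = p)
    (v : V) (hv : IsDiscreteValuationRing (V.presheaf.stalk v)) :
    ∃ (y : L) (s : V.presheaf.stalk v), y ∉ Set.range (algebraMap V.functionField L) ∧
      algebraMap V.functionField L (algebraMap (V.presheaf.stalk v) V.functionField s) = y ^ p ∧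
      ((s ∈ maximalIdeal (V.presheaf.stalk v) ∧
          maximalIdeal (V.presheaf.stalk v) = Ideal.span {s}) ∨
        (IsUnit s ∧ ∀ c : V.presheaf.stalk v, s - c ^ p ∉ maximalIdeal (V.presheaf.stalk v))) := by
  haveI : CharP V.functionField p := by
    let φ : k →+* V.functionField := (V.presheaf.germ ⊤ _ trivial).hom.comp
      ((f.appTop).hom.comp (Scheme.ΓSpecIso (.of k)).inv.hom)
    exact (φ.charP_iff_charP p).mp inferInstance
  haveI : FiniteDimensional V.functionField L :=
    Module.finite_of_finrank_pos (by rw [hdeg]; exact hp.pos)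
  haveI : CharP L p := charP_of_injective_algebraMap (algebraMap V.functionField L).injective p
  obtain ⟨hLp, y₀, g₀, hy₀, -, -⟩ := stub_generator (K := V.functionField) (L := L) p hp hdeg
  -- `L` as an `𝒪_{V,v}`-algebra through `K(V)`
  letI : Algebra (V.presheaf.stalk v) L :=
    ((algebraMap V.functionField L).comp (algebraMap (V.presheaf.stalk v) V.functionField)).toAlgebra
  haveI : IsScalarTower (V.presheaf.stalk v) V.functionField L :=
    IsScalarTower.of_algebraMap_eq (fun a => rfl)
  haveI := hv
  have hfin := finite_integralClosure_stalk V f L v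
  obtain ⟨hB, hBp, hBK⟩ := stub_dvrNormalization (O := V.presheaf.stalk v)
    (K := V.functionField) (L := L) p hp hLp ⟨y₀, hy₀⟩ hfin
  obtain ⟨y, s, hy, hys, hcase⟩ := stub_dvrClean (O := V.presheaf.stalk v)
    (K := V.functionField) (L := L) p hp hB hBp hBK hfin
  refine ⟨y, s, hy, hys, ?_⟩
  rcases hcase with ⟨hs1, hs2⟩ | h
  · -- `s ∈ 𝔪 ∖ 𝔪²` is a uniformizer of the DVR `𝒪_{V,v}`
    left
    refine ⟨hs1, (IsDiscreteValuationRing.irreducible_iff_uniformizer s).mp ?_⟩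
    have hs0 : s ≠ 0 := by
      rintro rfl
      exact hs2 (Ideal.zero_mem _)
    refine ⟨fun hu => hs1 |> (mem_maximalIdeal s).mp <| hu, fun a b hab => ?_⟩
    by_contra hne
    obtain ⟨ha, hb⟩ := not_or.mp hne
    apply hs2
    rw [hab, pow_two]
    exact Ideal.mul_mem_mul ((mem_maximalIdeal a).mpr ha) ((mem_maximalIdeal b).mpr hb)
  · exact Or.inr h

/-- **Clean generators at codimension-one points of a regular scheme.** The same conclusion at a
point `v` whose local ring is regular of dimension one (= a DVR, Matsumura Thm. 11.2; tree
`isDiscreteValuationRing_of_ringKrullDim_eq_one`): the generic point of any prime divisor of a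
regular `V`. This is the codimension-one termination input of the dimension-2 programme for
`CleanModels` over an arbitrary ground field (no `F`-finiteness, no excellence lemma).
[cite: Matsumura1987, Thm. 11.2] -/
theorem exists_clean_generator_of_ringKrullDim_stalk_eq_one (p : ℕ) (hp : p.Prime)
    (k : Type) [Field k] [CharP k p] (V : Scheme.{0}) [IsIntegral V] (f : V ⟶ Spec (.of k))
    [LocallyOfFiniteType f] (L : Type) [Field L] [Algebra V.functionField L]
    [IsPurelyInseparable V.functionField L] (hdeg : Module.finrank V.functionField L = p)
    (v : V) (hreg : IsRegularLocalRing (V.presheaf.stalk v))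
    (hdim : ringKrullDim (V.presheaf.stalk v) = 1) :
    ∃ (y : L) (s : V.presheaf.stalk v), y ∉ Set.range (algebraMap V.functionField L) ∧
      algebraMap V.functionField L (algebraMap (V.presheaf.stalk v) V.functionField s) = y ^ p ∧
      ((s ∈ maximalIdeal (V.presheaf.stalk v) ∧
          maximalIdeal (V.presheaf.stalk v) = Ideal.span {s}) ∨
        (IsUnit s ∧ ∀ c : V.presheaf.stalk v, s - c ^ p ∉ maximalIdeal (V.presheaf.stalk v))) :=
  haveI := hreg
  exists_clean_generator_of_isDiscreteValuationRing_stalk p hp k V f L hdeg v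
    (Literature.RingTheory.RegularLocalRing.isDiscreteValuationRing_of_ringKrullDim_eq_one hdim)

end Summit.ResolutionOfSingularities.ResolutionOfSingularities.Theorems.RadicialJung.CleanModels

end
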